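import Literature.Combinatorics.LorentzianPolynomials.LoopMultipartiteSignature
import HarnessLib

/-!
# The signature of the Hessian of `∂^α Z_{q,M}`: the loop / parallel-class matrix with parameter `0 ≤ q ≤ 1` has at
# most one positive eigenvalue (Brändén–Huh 2020, §4.3, proof of Thm. 4.10 with Lemma 4.12)

Layer `Literature/Combinatorics/LorentzianPolynomials`, namespace `Literature.Combinatorics.LorentzianPolynomials`;
lane `lit-hodgefound` (Track 2 foundations library), seat p16, generation 28 (row g28-#8 (a)). The linear-algebra core of
Brändén–Huh's Theorem 4.10 (the homogeneous multivariate Tutte polynomial `Z_{q,M}` is Lorentzian for `0 < q ≤ 1`),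
abstracted from the matroid and generalising `sigPos_loopMultipartite_le_one` (`LoopMultipartiteSignature.lean`, the
`q → 0` end used for `f_M`): on the index set `Option τ` (`none` = the homogenising variable `w_0`), for a finite set `T ⊆ τ`
of "live" variables (the ground set of the contraction `M/S`, `#T = m`), a map `p : τ → κ` ("parallel class", loops being
singleton classes) and reals `q`, `m`, the symmetric matrix
`H = [[m(m-1), (m-1)·𝟙_T^T], [(m-1)·𝟙_T, ([k ≠ l ∈ T] · (q if p k = p l, 1 otherwise))_{k,l}]]`
has at most one positive eigenvalue whenever `#T ≤ m`, `1 < m` and `0 ≤ q ≤ 1`. This is — after Brändén–Huh's change of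
variables `w_i ↦ q w_i` on the non-loops and up to the factor `(m-2)!` — the Hessian of the quadratic form
`(m!/2) w_0^2 + (m-1)! Z^1_{q,M/S}(w) w_0 + (m-2)! Z^2_{q,M/S}(w)`, whose stability is the heart of the printed proof. Proof as
printed: on the `H`-orthogonal complement of `e_0` (`m z_0 = -s`, `s = Σ_{k∈T} z_k`) one has
`m · zᵀHz = s² - m((1-q) Σ_c s_c² + q Σ_k z_k²) ≤ 0`, a convex combination of the two Cauchy–Schwarz inequalities
`s² ≤ #T · Σ_c s_c²` (Lemma 4.12 for the classes, `sq_sum_le_card_mul_sum_fiber_sq_of_subset`) and `s² ≤ #T · Σ_k z_k²`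
(Lemma 4.12 with `m = n`) — "When `q = 1`, the desired inequality directly follows from the case `m = n` of Lemma 4.12 […]
The conclusion now follows from Lemma 4.12."

## Source (verbatim) — P. Brändén, J. Huh, *Lorentzian polynomials* [BrandenHuh2019] (held `paper:arxiv-1902.03719`)

§4.3, proof of Thm. 4.10: "Thus, it is enough to prove that the following quadratic form is stable:
`(n!/2) w_0^2 + (n-1)! Z^1_{q,M}(w) w_0 + (n-2)! Z^2_{q,M}(w)`. […] it suffices to show that the discriminant of the
displayed quadratic form with respect to `w_0` is nonnegative: `Z^1_{q,M}(w)^2 ≥ 2 (n/(n-1)) Z^2_{q,M}(w)` for all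
`w ∈ ℝ^n`. We prove the inequality after making the change of variables `w_i ↦ w_i` if `i` is a loop in `M`, `w_i ↦ q w_i`
if `i` is not a loop in `M`. Write `L ⊆ [n]` for the set of loops and `P_1, …, P_ℓ ⊆ [n] ∖ L` for the parallel classes in
`M` [Oxley]. The above change of variables gives `Z^1_{q,M}(w) = e^1_{[n]}(w)` and
`Z^2_{q,M}(w) = e^2_{[n]}(w) - (1-q)(e^2_{P_1}(w) + ⋯ + e^2_{P_ℓ}(w))`. When `q = 1`, the desired inequality directly
follows from the case `m = n` of Lemma 4.12. […] Note that the left-hand side of the above inequality simplifies to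
`n (e^1_{P_1}(w)^2 + ⋯ + e^1_{P_ℓ}(w)^2 + Σ_{i ∈ L} w_i^2) - e^1_{[n]}(w)^2`. The conclusion now follows from Lemma 4.12."

## What is here

* `pottsMatrix T p q m` (the matrix `H` above on `Option τ`), its entries and symmetry;
* `toBilin'_pottsMatrix_single_none` (`z^T H e_0 = m(m-1) z_0 + (m-1) s`), `toBilin'_pottsMatrix_self`
  (`z^T H z = m(m-1) z_0² + 2(m-1) z_0 s + Σ_{k ≠ l ∈ T} c_{kl} z_k z_l`), `sum_sum_pottsEntry_mul_eq` (the last sum is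
  `(1-q)(s² - Σ_c s_c²) + q(s² - Σ_k z_k²)`);
* **`sigPos_pottsMatrix_le_one`** (`#T ≤ m`, `1 < m`, `0 ≤ q ≤ 1` ⟹ at most one positive eigenvalue), via
  `sigPos_le_one_of_orthogonal_nonpos` at `e_0` and Lemma 4.12 twice.

One definition with body (`pottsMatrix`), theorems otherwise; no `sorry`, no named fact.

## References

* [BrandenHuh2019] P. Brändén, J. Huh, *Lorentzian polynomials*, Ann. of Math. (2) 192 (2020) 821–891, arXiv:1902.03719 —
  §4.3 Thm. 4.10 and its proof, Lemma 4.12.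
-/

noncomputable section

open Finset Matrix
open Literature.LinearAlgebra.QuadraticForm

namespace Literature.Combinatorics.LorentzianPolynomials

variable {τ κ : Type*} [Fintype τ] [DecidableEq τ] [DecidableEq κ]

/-! ## §1 The matrix -/

section Matrix

/-- **The "loop / parallel-class" matrix with parameter `q`** on `Option τ`: `H_{00} = m(m-1)`,
`H_{0k} = H_{k0} = (m-1)[k ∈ T]`, and for `k, l ∈ T`, `k ≠ l`: `H_{kl} = q` if `p k = p l` (parallel non-loops) and `1`
otherwise (so `H_{kk} = 0`, and `H` vanishes outside `T`): up to the factor `(m-2)!` and Brändén–Huh's rescaling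
`w_i ↦ q w_i` of the non-loops, the Hessian of `∂^α Z_{q,M}` for `α = (m-2) e_0 + e_S` (`T` = ground set of `M/S`,
`p` = parallel class, loops in singleton classes). [cite: BrandenHuh2019, §4.3 proof of Thm. 4.10
("`Z^2_{q,M}(w) = e^2_{[n]}(w) - (1-q)(e^2_{P_1}(w) + ⋯ + e^2_{P_ℓ}(w))`")] -/
def pottsMatrix (T : Finset τ) (p : τ → κ) (q m : ℝ) : Matrix (Option τ) (Option τ) ℝ :=
  Matrix.of fun i j ↦ Option.elim i
    (Option.elim j (m * (m - 1)) fun l ↦ if l ∈ T then m - 1 else 0)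
    fun k ↦ Option.elim j (if k ∈ T then m - 1 else 0) fun l ↦
      if k ∈ T ∧ l ∈ T ∧ k ≠ l then (if p k = p l then q else 1) else 0

omit [Fintype τ] in
/-- `H_{00} = m(m-1)`. [cite: BrandenHuh2019, §4.3 proof of Thm. 4.10] -/
theorem pottsMatrix_none_none (T : Finset τ) (p : τ → κ) (q m : ℝ) :
    pottsMatrix T p q m none none = m * (m - 1) := rfl

omit [Fintype τ] in
/-- `H_{0l} = (m-1)[l ∈ T]`. [cite: BrandenHuh2019, §4.3 proof of Thm. 4.10] -/
theorem pottsMatrix_none_some (T : Finset τ) (p : τ → κ) (q m : ℝ) (l : τ) :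
    pottsMatrix T p q m none (some l) = if l ∈ T then m - 1 else 0 := rfl

omit [Fintype τ] in
/-- `H_{k0} = (m-1)[k ∈ T]`. [cite: BrandenHuh2019, §4.3 proof of Thm. 4.10] -/
theorem pottsMatrix_some_none (T : Finset τ) (p : τ → κ) (q m : ℝ) (k : τ) :
    pottsMatrix T p q m (some k) none = if k ∈ T then m - 1 else 0 := rfl

omit [Fintype τ] in
/-- `H_{kl} = [k, l ∈ T, k ≠ l] · (q if p k = p l, else 1)`. [cite: BrandenHuh2019, §4.3 proof of Thm. 4.10] -/
theorem pottsMatrix_some_some (T : Finset τ) (p : τ → κ) (q m : ℝ) (k l : τ) :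
    pottsMatrix T p q m (some k) (some l) =
      if k ∈ T ∧ l ∈ T ∧ k ≠ l then (if p k = p l then q else 1) else 0 := rfl

omit [Fintype τ] in
/-- `H` is symmetric (entrywise). [cite: BrandenHuh2019, §4.3 proof of Thm. 4.10] -/
theorem pottsMatrix_comm (T : Finset τ) (p : τ → κ) (q m : ℝ) (i j : Option τ) :
    pottsMatrix T p q m i j = pottsMatrix T p q m j i := by
  cases i with
  | none => cases j with
    | none => rfl
    | some l => rfl
  | some k => cases j with
    | none => rfl
    | some l =>
      rw [pottsMatrix_some_some, pottsMatrix_some_some]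
      by_cases h : k ∈ T ∧ l ∈ T ∧ k ≠ l
      · have h' : l ∈ T ∧ k ∈ T ∧ l ≠ k := ⟨h.2.1, h.1, fun e ↦ h.2.2 e.symm⟩
        rw [if_pos h, if_pos h']
        exact if_congr eq_comm rfl rfl
      · have h' : ¬ (l ∈ T ∧ k ∈ T ∧ l ≠ k) := fun h' ↦ h ⟨h'.2.1, h'.1, fun e ↦ h'.2.2 e.symm⟩
        rw [if_neg h, if_neg h']

omit [Fintype τ] in
/-- `H` is a symmetric matrix. [cite: BrandenHuh2019, §4.3 proof of Thm. 4.10] -/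
theorem isSymm_pottsMatrix (T : Finset τ) (p : τ → κ) (q m : ℝ) : (pottsMatrix T p q m).IsSymm :=
  Matrix.IsSymm.ext fun i j ↦ pottsMatrix_comm T p q m j i

end Matrix

/-! ## §2 The quadratic form on `e_0^⊥` and its signature -/

section Signature

/-- `z^T H e_0 = m(m-1) z_0 + (m-1) Σ_{k∈T} z_k`. [cite: BrandenHuh2019, §4.3 proof of Thm. 4.10] -/
theorem toBilin'_pottsMatrix_single_none (T : Finset τ) (p : τ → κ) (q m : ℝ) (z : Option τ → ℝ) :
    Matrix.toBilin' (pottsMatrix T p q m) z (Pi.single none 1) =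
      m * (m - 1) * z none + (m - 1) * ∑ k ∈ T, z (some k) := by
  rw [Matrix.toBilin'_apply]
  simp_rw [Fintype.sum_option, Pi.single_eq_same, Pi.single_eq_of_ne (Option.some_ne_none _), mul_zero,
    Finset.sum_const_zero, add_zero, mul_one, pottsMatrix_none_none, pottsMatrix_some_none]
  rw [Finset.mul_sum, ← Finset.sum_filter_add_sum_filter_not univ (· ∈ T)]
  have h1 : ∑ k ∈ univ.filter (· ∈ T), z (some k) * (if k ∈ T then m - 1 else 0) = ∑ k ∈ T, (m - 1) * z (some k) := by
    rw [Finset.filter_mem_eq_inter, Finset.univ_inter]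
    exact Finset.sum_congr rfl fun k hk ↦ by rw [if_pos hk, mul_comm]
  have h2 : ∑ k ∈ univ.filter (fun k ↦ ¬ k ∈ T), z (some k) * (if k ∈ T then m - 1 else 0) = 0 :=
    Finset.sum_eq_zero fun k hk ↦ by rw [if_neg (Finset.mem_filter.1 hk).2, mul_zero]
  rw [h1, h2, add_zero]
  ring

/-- `z^T H z = m(m-1) z_0² + 2(m-1) z_0 s + Σ_{k, l ∈ T, k ≠ l} c_{kl} z_k z_l` with `s = Σ_{k∈T} z_k` and `c_{kl} = q` if
`p k = p l`, `1` otherwise. [cite: BrandenHuh2019, §4.3 proof of Thm. 4.10] -/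
theorem toBilin'_pottsMatrix_self (T : Finset τ) (p : τ → κ) (q m : ℝ) (z : Option τ → ℝ) :
    Matrix.toBilin' (pottsMatrix T p q m) z z =
      m * (m - 1) * z none ^ 2 + 2 * (m - 1) * z none * (∑ k ∈ T, z (some k)) +
        ∑ k ∈ T, ∑ l ∈ T, if k ≠ l then (if p k = p l then q else 1) * (z (some k) * z (some l)) else 0 := by
  rw [Matrix.toBilin'_apply, Fintype.sum_option]
  simp_rw [Fintype.sum_option, pottsMatrix_none_none, pottsMatrix_none_some, pottsMatrix_some_none, pottsMatrix_some_some]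
  have hA : ∑ l : τ, z none * (if l ∈ T then m - 1 else 0) * z (some l) = (m - 1) * z none * ∑ k ∈ T, z (some k) := by
    rw [Finset.mul_sum, ← Finset.sum_subset (Finset.subset_univ T) (fun l _ hl ↦ by rw [if_neg hl, mul_zero, zero_mul])]
    exact Finset.sum_congr rfl fun l hl ↦ by rw [if_pos hl]; ring
  have hB : ∑ k : τ, z (some k) * (if k ∈ T then m - 1 else 0) * z none = (m - 1) * z none * ∑ k ∈ T, z (some k) := by
    rw [Finset.mul_sum, ← Finset.sum_subset (Finset.subset_univ T) (fun k _ hk ↦ by rw [if_neg hk, mul_zero, zero_mul])]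
    exact Finset.sum_congr rfl fun k hk ↦ by rw [if_pos hk]; ring
  have hC : ∑ k : τ, ∑ l : τ, z (some k) * (if k ∈ T ∧ l ∈ T ∧ k ≠ l then (if p k = p l then q else 1) else 0) * z (some l) =
      ∑ k ∈ T, ∑ l ∈ T, if k ≠ l then (if p k = p l then q else 1) * (z (some k) * z (some l)) else 0 := by
    rw [← Finset.sum_subset (Finset.subset_univ T) (fun k _ hk ↦ Finset.sum_eq_zero fun l _ ↦ by
      rw [if_neg (fun h ↦ hk h.1), mul_zero, zero_mul])]
    refine Finset.sum_congr rfl fun k hk ↦ ?_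
    rw [← Finset.sum_subset (Finset.subset_univ T) (fun l _ hl ↦ by rw [if_neg (fun h ↦ hl h.2.1), mul_zero, zero_mul])]
    refine Finset.sum_congr rfl fun l hl ↦ ?_
    by_cases h : k ≠ l
    · rw [if_pos ⟨hk, hl, h⟩, if_pos h]; ring
    · rw [if_neg (fun h' ↦ h h'.2.2), if_neg h, mul_zero, zero_mul]
  simp_rw [Finset.sum_add_distrib]
  rw [hA, hB, hC]
  ring

omit [Fintype τ] [DecidableEq κ] in
/-- The `T × T` block of `zᵀHz` in closed form: with `s = Σ_{k∈T} z_k`, `C = Σ_c s_c²` (`s_c = Σ_{k∈T, p k = c} z_k`) and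
`N = Σ_{k∈T} z_k²`, `Σ_{k ≠ l ∈ T} c_{kl} z_k z_l = (1-q)(s² - C) + q(s² - N)` ("`e^2_{[n]} - (1-q)(e^2_{P_1} + ⋯ + e^2_{P_ℓ})`",
doubled). [cite: BrandenHuh2019, §4.3 proof of Thm. 4.10] -/
theorem sum_sum_pottsEntry_mul_eq [DecidableEq κ] (T : Finset τ) (p : τ → κ) (q : ℝ) (x : τ → ℝ) :
    ∑ k ∈ T, ∑ l ∈ T, (if k ≠ l then (if p k = p l then q else 1) * (x k * x l) else 0) =
      (1 - q) * ((∑ k ∈ T, x k) ^ 2 - ∑ c ∈ T.image p, (∑ k ∈ T.filter (fun k ↦ p k = c), x k) ^ 2) +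
        q * ((∑ k ∈ T, x k) ^ 2 - ∑ k ∈ T, x k ^ 2) := by
  -- the "independent pairs" sum `Σ_{p k ≠ p l} x_k x_l = s² - C` (`sum_sum_ite_ne_eq`), the full sum `Σ_{k,l} x_k x_l = s²`
  have hne := sum_sum_ite_ne_eq T p x
  have hsq : (∑ k ∈ T, x k) ^ 2 = ∑ k ∈ T, ∑ l ∈ T, x k * x l := by rw [sq, Finset.sum_mul_sum]
  have hdiag : ∑ k ∈ T, x k ^ 2 = ∑ k ∈ T, ∑ l ∈ T, if k = l then x k * x l else 0 := by
    refine Finset.sum_congr rfl fun k hk ↦ ?_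
    rw [Finset.sum_ite_eq T k, if_pos hk, sq]
  -- entrywise identity: `[k ≠ l] c_{kl} x_k x_l = (1-q) [p k ≠ p l] x_k x_l + q (x_k x_l - [k = l] x_k x_l)`
  rw [hne.symm, hsq, hdiag, ← Finset.sum_sub_distrib, Finset.mul_sum, Finset.mul_sum, ← Finset.sum_add_distrib]
  refine Finset.sum_congr rfl fun k _ ↦ ?_
  rw [← Finset.sum_sub_distrib, Finset.mul_sum, Finset.mul_sum, ← Finset.sum_add_distrib]
  refine Finset.sum_congr rfl fun l _ ↦ ?_
  by_cases hkl : k = l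
  · subst hkl
    simp
  · by_cases hp : p k = p l
    · simp [hkl, hp]
    · simp [hkl, hp]; ring

/-- **The Hessian of `∂^α Z_{q,M}` has at most one positive eigenvalue** (abstract form): for `#T ≤ m`, `1 < m` and
`0 ≤ q ≤ 1`, the matrix `H = pottsMatrix T p q m` has `sigPos ≤ 1`. On the `H`-orthogonal complement of `e_0`
(`m z_0 = -s`) one has `m · zᵀHz = s² - m((1-q) Σ_c s_c² + q Σ_k z_k²) ≤ 0`, a convex combination of Lemma 4.12 for the
classes and of Lemma 4.12 with `m = n` ("When `q = 1`, the desired inequality directly follows from the case `m = n` of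
Lemma 4.12 […] The conclusion now follows from Lemma 4.12"). [cite: BrandenHuh2019, §4.3 proof of Thm. 4.10, Lemma 4.12] -/
theorem sigPos_pottsMatrix_le_one (T : Finset τ) (p : τ → κ) {q m : ℝ} (hq : 0 ≤ q) (hq1 : q ≤ 1)
    (hT : (T.card : ℝ) ≤ m) (hm : 1 < m) :
    sigPos (Matrix.toBilin' (pottsMatrix T p q m)).toQuadraticMap ≤ 1 := by
  refine sigPos_le_one_of_orthogonal_nonpos (Matrix.toBilin' (pottsMatrix T p q m)) (w := Pi.single none 1)
    fun z hz ↦ ?_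
  rw [toBilin'_pottsMatrix_single_none] at hz
  rw [toBilin'_pottsMatrix_self, sum_sum_pottsEntry_mul_eq]
  set s := ∑ k ∈ T, z (some k) with hs
  set C := ∑ c ∈ T.image p, (∑ k ∈ T.filter (fun k ↦ p k = c), z (some k)) ^ 2 with hC
  set N := ∑ k ∈ T, z (some k) ^ 2 with hN
  have hCS₁ : s ^ 2 ≤ T.card * C := sq_sum_le_card_mul_sum_fiber_sq_of_subset T p (fun k ↦ z (some k))
  have hCS₂ : s ^ 2 ≤ T.card * N := sq_sum_le_card_mul_sum_sq
  have hC0 : 0 ≤ C := Finset.sum_nonneg fun _ _ ↦ sq_nonneg _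
  have hN0 : 0 ≤ N := Finset.sum_nonneg fun _ _ ↦ sq_nonneg _
  have hsmC : s ^ 2 ≤ m * C := hCS₁.trans (mul_le_mul_of_nonneg_right hT hC0)
  have hsmN : s ^ 2 ≤ m * N := hCS₂.trans (mul_le_mul_of_nonneg_right hT hN0)
  have hz0 : m * z none = -s := by
    have h : (m - 1) * (m * z none + s) = 0 := by linarith
    rcases mul_eq_zero.1 h with h1 | h1
    · linarith
    · linarith
  have hm0 : 0 < m := by linarith
  -- `m · (zᵀHz) = s² - m((1-q) C + q N)`: multiply through by `m > 0`
  have key : m * (m * (m - 1) * z none ^ 2 + 2 * (m - 1) * z none * s +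
      ((1 - q) * (s ^ 2 - C) + q * (s ^ 2 - N))) = s ^ 2 - m * ((1 - q) * C + q * N) := by
    have : m * z none = -s := hz0
    nlinarith [this]
  -- the convex combination of the two Cauchy–Schwarz inequalities
  have hconv : s ^ 2 ≤ m * ((1 - q) * C + q * N) := by nlinarith [hsmC, hsmN, hq, hq1]
  have hle : m * (m * (m - 1) * z none ^ 2 + 2 * (m - 1) * z none * s +
      ((1 - q) * (s ^ 2 - C) + q * (s ^ 2 - N))) ≤ 0 := by
    rw [key]; linarith
  by_contra hpos
  exact absurd (mul_pos hm0 (lt_of_not_ge hpos)) (not_lt.2 hle)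

/-- The case `q = 1` (all off-diagonal entries of the `T × T` block equal to `1`): `sigPos ≤ 1` — Brändén–Huh's "When
`q = 1`, the desired inequality directly follows from the case `m = n` of Lemma 4.12". [cite: BrandenHuh2019, §4.3 proof of
Thm. 4.10] -/
theorem sigPos_pottsMatrix_one_le_one (T : Finset τ) (p : τ → κ) {m : ℝ} (hT : (T.card : ℝ) ≤ m) (hm : 1 < m) :
    sigPos (Matrix.toBilin' (pottsMatrix T p 1 m)).toQuadraticMap ≤ 1 :=
  sigPos_pottsMatrix_le_one T p zero_le_one le_rfl hT hm

end Signature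

end Literature.Combinatorics.LorentzianPolynomials

end
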